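import Literature.Probability.LatticeModels.SharpLengthDCPFromReflected
import Literature.Probability.LatticeModels.SusceptibilityMeanFieldBound
import Literature.Probability.LatticeModels.DirInvCorrLength
import Literature.Probability.LatticeModels.PlusFreeComparison
import Literature.Probability.LatticeModels.PlusStateFKG
import Literature.Probability.LatticeModels.CriticalTwoPointLower
import HarnessLib

/-!
# The sharp length against the susceptibility and the correlation length

Topic `Literature/Probability/LatticeModels`; family `crit-ising`. PROOF file (no definitions, no named
facts): elementary comparisons between the Duminil-Copin–Panis **sharp length**
`L(β) = sharpLength d β` (CMP 406 (2025), arXiv:2404.05700, Def. 1.1; tree file `SharpLengthDCP.lean`),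
the susceptibility `χ(β) = susceptibility d β` and the plus-state axis correlation length
`ξ(β) = isingCorrLength d β` of the nearest-neighbour Ising model, all below `β_c`:

* `dcpPhi_box_succ_le`, `half_le_shellSum`, `shellSum_ge`, `boxSum_twoPointFree_ge` — Definition 1.1
  read on boxes: for `k + 1 < L(β)` the shell sum `Σ_{x ∈ ∂Λ_{k+1}} ⟨σ₀σ_x⟩^∅_β` is at least
  `1/(4dβ)` (since `1/2 ≤ φ_β(Λ_{k+1}) ≤ 2dβ · Σ_{∂Λ_{k+1}} ⟨σ₀σ_x⟩^∅_β`, GKS), hence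
  `Σ_{Λ_ℓ} ⟨σ₀σ_x⟩^∅_β ≥ 1 + ℓ/(4dβ)` for `ℓ + 1 ≤ L(β)`;
* `susceptibility_toReal_ge_of_le_sharpLength`, `sharpLength_ne_top_of_lt_criticalBeta`,
  `exists_sharpLength_eq` — on `ℤ³`, `0 < β < β_c`: `L(β) < ∞` (finite susceptibility below `β_c`,
  Aizenman–Barsky–Fernández) and `L(β) ≤ (12β + 1)·χ(β)` ("`χ ≥ c·L`");
* `isingCorrLength_le_mul_sharpLength` — on `ℤ³`: `ξ(β) ≤ L(β)/c`, `c` the rate of eq. (1.4) of the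
  source (`dcp_nearCritical_upper_holds`: `⟨σ₀σ_x⟩_β ≤ C (1/(|x| ∧ L(β)))^{d-2} e^{-c|x|/L(β)}`), read along
  the axis and passed to the limit defining `ξ(β)⁻¹`; with the previous item,
  `isingCorrLength_le_mul_susceptibility`: `ξ(β) ≤ C·χ(β)` (Simon's `γ ≥ ν` in amplitude form);
* `shellSum_le_card_mul_exp`, `exists_sharpLength_le_corrLength_log` — the converse up to a logarithm on
  `ℤ³`: `Σ_{∂Λ_k} ⟨σ₀σ_x⟩^∅_β ≤ |∂Λ_k| e^{-k/ξ(β)}` (Messager–Miracle-Solé through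
  `supNorm_mul_dirInvCorrLength_axis_le`) and hence `L(β) ≤ 5 ξ(β) log ξ(β) + 1` as soon as
  `ξ(β) ≥ 3 ∨ (45000 β_c + 1)` (the box `Λ_k`, `k = ⌈5ξ log ξ⌉`, witnesses Def. 1.1:
  `φ_β(Λ_k) ≤ 36β(2k+1)² e^{-k/ξ} ≤ 22500β/ξ < 1/2`).

So `c·ξ(β) ≤ L(β) ≤ 5ξ(β) log ξ(β) + 1` near `β_c(3)`: the two near-critical lengths agree up to a
logarithm (the source, p. 6: "the relation between these quantities is not clear a priori"; its
Thm. 1.6 gives `L(β) = ξ(β)^{1+o(1)}` for `d ≥ 4`). The shell/box lemmas are stated for general `d`;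
the comparisons with `χ` and `ξ` for `d = 3`, the case consumed by the routes of
`Summits/CriticalPhenomena/Ising3DConformalLimit` (cruxes `NearCriticalLeeYangGap`,
`CorrelationLengthWindow`) — `-- TODO(general form): d ≥ 3` with the same proofs and `d`-dependent
constants. Written by the lead prover of crux `NearCriticalLeeYangGap` (stmt-CriticalPhenomena-4945) from
the census of its stub `stub_susceptibilityComparabilityOneScale` (2026-08-17).

## References

* H. Duminil-Copin, R. Panis, *New lower bounds for the (near) critical Ising and φ⁴ models'
  two-point functions*, CMP 406 (2025), arXiv:2404.05700 — Def. 1.1, eq. (1.4), §1 p. 6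
  [DuminilCopinPanis2025LowerBounds].
* M. Aizenman, D. Barsky, R. Fernández, J. Stat. Phys. 47 (1987), Thm. 1 [AizenmanBarskyFernandezJSP1987].
* A. Messager, S. Miracle-Solé, J. Stat. Phys. 17 (1977) [MessagerMiracleSoleJSP1977].
* B. Simon, CMP 77 (1980) 111–126 [Simon1980CMP].
* S. Friedli, Y. Velenik, *Statistical Mechanics of Lattice Systems* (CUP 2017), §3.7.4, §3.10.7
  [FriedliVelenik2017].
-/

noncomputable section

namespace Literature.Probability.LatticeModels

open Filter Set Finset
open scoped _root_.Topology BigOperators ENNReal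

/-- `φ_β(Λ_{k+1}) ≤ β · 2d · Σ_{x ∈ ∂Λ_{k+1}} ⟨σ₀σ_x⟩^∅_β` for `β ≥ 0` (the boundary term of
Def. 1.1 on a box: each `x ∈ ∂Λ_{k+1}` has at most `2d` outer neighbours, and
`⟨σ₀σ_x⟩^∅_{Λ;β} ≤ ⟨σ₀σ_x⟩^∅_β` by GKS). [cite: DuminilCopinPanis2025LowerBounds, Def. 1.1] -/
theorem dcpPhi_box_succ_le {d : ℕ} {β : ℝ} (hβ : 0 ≤ β) (k : ℕ) :
    dcpPhi d β (box d (k + 1)) ≤ β * (2 * d) * ∑ x ∈ sphere d (k + 1), twoPointFree d β x := by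
  have hgks : ∀ {Λ A : Finset (Site d)} {β h : ℝ} {bc : BoundaryCondition (Site d)},
      gks_one (zdGraph d) (Λ := Λ) (A := A) (β := β) (h := h) (bc := bc) :=
    GKSInequalities.gks_one_holds (zdGraph d)
  have hgks2 : ∀ (G' : SimpleGraph (Site d)) [G'.LocallyFinite] (Λ A B : Finset (Site d))
      (β h : ℝ) (bc : BoundaryCondition (Site d)),
      gks_two G' (Λ := Λ) (A := A) (B := B) (β := β) (h := h) (bc := bc) :=
    fun G' _ _ _ _ _ _ _ => GKSInequalities.gks_two_holds G'
  have hlim : hasBoxLimit_isingCorr_free d := hasBoxLimit_isingCorr_free_holds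
  have hmono : isingCorr_free_mono_volume (d := d) := isingCorr_free_mono_volume_of_gks_two hgks2
  unfold dcpPhi
  rw [mul_assoc]
  refine mul_le_mul_of_nonneg_left ?_ hβ
  have hrhs : (2 * (d : ℝ)) * ∑ x ∈ sphere d (k + 1), twoPointFree d β x =
      ∑ x ∈ box d (k + 1),
        if Site.supNorm x = k + 1 then 2 * (d : ℝ) * twoPointFree d β x else 0 := by
    rw [Finset.mul_sum, sphere, Finset.sum_filter]
  rw [hrhs]
  refine Finset.sum_le_sum fun x hx => ?_
  have hxk : Site.supNorm x ≤ k + 1 := mem_box_iff_supNorm_le.1 hx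
  have hT0 : 0 ≤ isingTwoPoint (zdGraph d) (box d (k + 1)) β 0 .free 0 x :=
    isingTwoPoint_free_nonneg hgks hβ (zero_mem_box d (k + 1)) hx
  split_ifs with hxs
  · have hcard : ((((zdGraph d).neighborFinset x).filter fun y => y ∉ box d (k + 1)).card : ℝ) ≤
        2 * d := by
      have h1 : (((zdGraph d).neighborFinset x).filter fun y => y ∉ box d (k + 1)).card ≤
          ((zdGraph d).neighborFinset x).card := card_filter_le _ _
      rw [card_neighborFinset_zdGraph_holds (d := d) x] at h1
      exact_mod_cast h1
    have hT : isingTwoPoint (zdGraph d) (box d (k + 1)) β 0 .free 0 x ≤ twoPointFree d β x :=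
      isingTwoPoint_free_box_le_twoPointFree hmono hlim hβ hx
    have hG0 : 0 ≤ twoPointFree d β x := twoPointFree_nonneg hlim hgks hβ x
    exact mul_le_mul hcard hT hT0 (by positivity)
  · have hempty : ((zdGraph d).neighborFinset x).filter (fun y => y ∉ box d (k + 1)) = ∅ := by
      refine Finset.filter_false_of_mem fun y hy => not_not.2 ?_
      rw [SimpleGraph.mem_neighborFinset] at hy
      rw [mem_box_iff_supNorm_le]
      have := Site.supNorm_le_succ_of_adj hy
      omega
    rw [hempty, Finset.card_empty, Nat.cast_zero, zero_mul]

/-! ### Shell sums below the sharp length -/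

/-- **Def. 1.1 on boxes**: for `k + 1 < L(β)`, `1/2 ≤ φ_β(Λ_{k+1}) ≤ β · 2d · Σ_{∂Λ_{k+1}} ⟨σ₀σ_x⟩^∅_β`.
[cite: DuminilCopinPanis2025LowerBounds, Def. 1.1] -/
theorem half_le_shellSum {d : ℕ} {β : ℝ} (hβ : 0 ≤ β) {k : ℕ}
    (hkL : ((k + 1 : ℕ) : ℕ∞) < sharpLength d β) :
    1 / 2 ≤ β * (2 * d) * ∑ x ∈ sphere d (k + 1), twoPointFree d β x :=
  (half_le_dcpPhi_of_subset_box (k := k + 1) (by omega) hkL (zero_mem_box d (k + 1))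
    subset_rfl).trans (dcpPhi_box_succ_le hβ k)

/-- Shell sums are bounded below by `1/(4dβ)` strictly below the sharp length.
[cite: DuminilCopinPanis2025LowerBounds, Def. 1.1] -/
theorem shellSum_ge {d : ℕ} (hd : 1 ≤ d) {β : ℝ} (hβ : 0 < β) {k : ℕ}
    (hkL : ((k + 1 : ℕ) : ℕ∞) < sharpLength d β) :
    1 / (4 * d * β) ≤ ∑ x ∈ sphere d (k + 1), twoPointFree d β x := by
  have h := half_le_shellSum hβ.le hkL
  have hd' : (0 : ℝ) < d := by exact_mod_cast hd
  rw [div_le_iff₀ (by positivity)]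
  have e : (∑ x ∈ sphere d (k + 1), twoPointFree d β x) * (4 * d * β) =
      2 * (β * (2 * d) * ∑ x ∈ sphere d (k + 1), twoPointFree d β x) := by ring
  rw [e]
  linarith

/-- `box d 0 = {0}`. [folklore] -/
theorem box_zero_eq_singleton_site {d : ℕ} : box d 0 = {0} := by
  ext z
  rw [mem_box_iff_supNorm_le, Nat.le_zero, Site.supNorm_eq_zero_iff, Finset.mem_singleton]

/-- **Box sums below the sharp length**: `Σ_{Λ_ℓ} ⟨σ₀σ_x⟩^∅_β ≥ 1 + ℓ/(4dβ)` whenever `ℓ + 1 ≤ L(β)`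
(the origin contributes `1`, each shell `∂Λ_j`, `1 ≤ j ≤ ℓ < L(β)`, at least `1/(4dβ)`). [cite: DuminilCopinPanis2025LowerBounds, Def. 1.1] -/
theorem boxSum_twoPointFree_ge {d : ℕ} (hd : 1 ≤ d) {β : ℝ} (hβ : 0 < β) :
    ∀ ℓ : ℕ, ((ℓ + 1 : ℕ) : ℕ∞) ≤ sharpLength d β →
      1 + (ℓ : ℝ) / (4 * d * β) ≤ ∑ x ∈ box d ℓ, twoPointFree d β x := by
  intro ℓ
  induction ℓ with
  | zero =>
      intro _
      rw [box_zero_eq_singleton_site, Finset.sum_singleton, twoPointFree_zero]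
      simp
  | succ k ih =>
      intro hL
      have hk : ((k + 1 : ℕ) : ℕ∞) ≤ sharpLength d β :=
        le_trans (by exact_mod_cast (by omega : k + 1 ≤ k + 1 + 1)) hL
      have hlt : ((k + 1 : ℕ) : ℕ∞) < sharpLength d β :=
        lt_of_lt_of_le (by exact_mod_cast (by omega : k + 1 < k + 1 + 1)) hL
      have h1 := ih hk
      have h2 := shellSum_ge hd hβ hlt
      rw [← Finset.sum_sdiff (box_mono d (Nat.le_succ k)), ← sphere_succ_eq_sdiff]
      push_cast
      calc 1 + ((k : ℝ) + 1) / (4 * d * β) = (1 + (k : ℝ) / (4 * d * β)) + 1 / (4 * d * β) := by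
            ring
        _ ≤ (∑ x ∈ box d k, twoPointFree d β x) + ∑ x ∈ sphere d (k + 1), twoPointFree d β x :=
            add_le_add h1 h2
        _ = (∑ x ∈ sphere d (k + 1), twoPointFree d β x) + ∑ x ∈ box d k, twoPointFree d β x :=
            add_comm _ _

/-! ### On `ℤ³`: `L(β) < ∞` and `L(β) ≤ (12β + 1) χ(β)` below `β_c` -/

/-- Finite partial sums of the susceptibility series: `Σ_{z ∈ Λ_n} ⟨σ₀σ_z⟩^∅_β ≤ χ(β)` for
`0 ≤ β < β_c(3)` (the terms are nonnegative by GKS and `χ(β) < ∞` below `β_c`).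
[cite: AizenmanBarskyFernandezJSP1987, Thm. 1] -/
private theorem sum_box_twoPointFree_le_susceptibility_toReal_lit {β : ℝ} (hβ : 0 ≤ β)
    (hβc : β < criticalBeta 3) (n : ℕ) :
    ∑ z ∈ box 3 n, twoPointFree 3 β z ≤ (susceptibility 3 β).toReal := by
  have hχ : susceptibility 3 β ≠ ⊤ :=
    (susceptibility_lt_top_of_lt_criticalBeta (d := 3) (by norm_num) hβ hβc).ne
  have hnn : ∀ z : Site 3, 0 ≤ twoPointFree 3 β z := fun z =>
    twoPointFree_nonneg hasBoxLimit_isingCorr_free_holds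
      (fun {_ _ _ _ _} => GKSInequalities.gks_one_holds (zdGraph 3)) hβ z
  unfold susceptibility at hχ ⊢
  have hle : ∑ z ∈ box 3 n, ENNReal.ofReal (twoPointFree 3 β z) ≤
      ∑' z : Site 3, ENNReal.ofReal (twoPointFree 3 β z) := ENNReal.sum_le_tsum _
  have h1 : ∑ z ∈ box 3 n, twoPointFree 3 β z =
      (∑ z ∈ box 3 n, ENNReal.ofReal (twoPointFree 3 β z)).toReal := by
    rw [ENNReal.toReal_sum (fun z _ => ENNReal.ofReal_ne_top)]
    exact Finset.sum_congr rfl fun z _ => (ENNReal.toReal_ofReal (hnn z)).symm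
  rw [h1]
  exact ENNReal.toReal_mono hχ hle

/-- For `0 < β < β_c(3)` and `ℓ + 1 ≤ L(β)`: `1 + ℓ/(12β) ≤ χ(β)` (partial sums of the susceptibility
series, finite below `β_c` by Aizenman–Barsky–Fernández sharpness). [cite: AizenmanBarskyFernandezJSP1987, Thm. 1] -/
theorem susceptibility_toReal_ge_of_le_sharpLength {β : ℝ} (hβ : 0 < β) (hβc : β < criticalBeta 3)
    {ℓ : ℕ} (hℓ : ((ℓ + 1 : ℕ) : ℕ∞) ≤ sharpLength 3 β) :
    1 + (ℓ : ℝ) / (12 * β) ≤ (susceptibility 3 β).toReal := by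
  have h := boxSum_twoPointFree_ge (d := 3) (by norm_num) hβ ℓ hℓ
  have e : (4 : ℝ) * (3 : ℕ) * β = 12 * β := by push_cast; ring
  rw [e] at h
  exact h.trans (sum_box_twoPointFree_le_susceptibility_toReal_lit hβ.le hβc ℓ)

/-- **The sharp length is finite below `β_c(3)`** (else `χ(β) ≥ 1 + ℓ/(12β)` for every `ℓ`,
contradicting `χ(β) < ∞`, Aizenman–Barsky–Fernández sharpness). [cite: AizenmanBarskyFernandezJSP1987, Thm. 1] -/
theorem sharpLength_ne_top_of_lt_criticalBeta {β : ℝ} (hβ : 0 < β) (hβc : β < criticalBeta 3) :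
    sharpLength 3 β ≠ ⊤ := by
  intro htop
  set χ : ℝ := (susceptibility 3 β).toReal with hχ
  obtain ⟨ℓ, hℓ⟩ : ∃ ℓ : ℕ, 12 * β * χ < ℓ := exists_nat_gt _
  have h := susceptibility_toReal_ge_of_le_sharpLength hβ hβc (ℓ := ℓ) (by rw [htop]; exact le_top)
  rw [← hχ] at h
  have h12 : (0 : ℝ) < 12 * β := by positivity
  have h' : (ℓ : ℝ) / (12 * β) > χ := by
    rw [gt_iff_lt, lt_div_iff₀ h12]
    linarith
  linarith

/-- **`χ(β) ≥ c L(β)` on `ℤ³`**: for `0 < β < β_c(3)` the sharp length is a natural number `ℓ ≥ 1`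
with `1 + (ℓ - 1)/(12β) ≤ χ(β)`, hence `ℓ ≤ (12β + 1) χ(β)`. [cite: DuminilCopinPanis2025LowerBounds, §1 (Def. 1.1)] -/
theorem exists_sharpLength_eq {β : ℝ} (hβ : 0 < β) (hβc : β < criticalBeta 3) :
    ∃ ℓ : ℕ, sharpLength 3 β = ℓ ∧ 1 ≤ ℓ ∧
      1 + ((ℓ : ℝ) - 1) / (12 * β) ≤ (susceptibility 3 β).toReal ∧
      (ℓ : ℝ) ≤ (12 * β + 1) * (susceptibility 3 β).toReal := by
  obtain ⟨ℓ, hℓ⟩ := ENat.ne_top_iff_exists.1 (sharpLength_ne_top_of_lt_criticalBeta hβ hβc)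
  have hℓ1 : 1 ≤ ℓ := by
    have h := one_le_sharpLength (d := 3) (β := β)
    rw [← hℓ] at h
    exact_mod_cast h
  have hmain := susceptibility_toReal_ge_of_le_sharpLength hβ hβc (ℓ := ℓ - 1)
    (by rw [← hℓ, Nat.sub_add_cancel hℓ1])
  have hcast : ((ℓ - 1 : ℕ) : ℝ) = (ℓ : ℝ) - 1 := by
    rw [Nat.cast_sub hℓ1, Nat.cast_one]
  rw [hcast] at hmain
  refine ⟨ℓ, hℓ.symm, hℓ1, hmain, ?_⟩
  set χ : ℝ := (susceptibility 3 β).toReal with hχ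
  have h12 : (0 : ℝ) < 12 * β := by positivity
  have hdiv : 0 ≤ ((ℓ : ℝ) - 1) / (12 * β) := by
    apply div_nonneg _ h12.le
    have : (1 : ℝ) ≤ ℓ := by exact_mod_cast hℓ1
    linarith
  have hχ1 : 1 ≤ χ := by linarith
  have hℓle : (ℓ : ℝ) - 1 ≤ 12 * β * (χ - 1) := by
    have h := hmain
    have : ((ℓ : ℝ) - 1) / (12 * β) ≤ χ - 1 := by linarith
    rwa [div_le_iff₀ h12, mul_comm] at this
  nlinarith

/-! ### `ξ(β) ≤ L(β)/c` -/

/-- **`ξ(β) ≤ L(β)/c` on `ℤ³`** (`0 < β < β_c(3)`, `L(β) = ℓ`): eq. (1.4) of Duminil-Copin–Panis 2025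
(`dcp_nearCritical_upper_holds`) gives `⟨σ₀σ_{ne₁}⟩^∅_β ≤ C₀ e^{-cn/ℓ}` along the axis, `⟨·⟩⁺ = ⟨·⟩^∅`
on pairs below `β_c` (`m*(β) = 0`), and `ξ(β)⁻¹ = lim_n -log⟨σ₀σ_{ne₁}⟩⁺_β/n ≥ c/ℓ`. [cite: DuminilCopinPanis2025LowerBounds, eq. (1.4)] -/
theorem isingCorrLength_le_mul_sharpLength :
    ∃ C : ℝ, 0 < C ∧ ∀ β : ℝ, 0 < β → β < criticalBeta 3 → ∀ ℓ : ℕ, sharpLength 3 β = ℓ →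
      isingCorrLength 3 β ≤ C * ℓ := by
  obtain ⟨c, C₀, hc, hC₀, hup⟩ := dcp_nearCritical_upper_holds (d := 3) (by norm_num)
  refine ⟨1 / c, by positivity, fun β hβ hβc ℓ hℓ => ?_⟩
  have hℓ1 : 1 ≤ ℓ := by
    have h := one_le_sharpLength (d := 3) (β := β)
    rw [hℓ] at h
    exact_mod_cast h
  have hℓpos : (0 : ℝ) < ℓ := by exact_mod_cast hℓ1
  set e : Site 3 := Pi.single 0 1 with he
  have he0 : e ≠ 0 := by
    intro h0
    have h0i := congrFun h0 0
    simp [he] at h0i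
  have hm : 0 < dirInvCorrLength 3 β e :=
    dirInvCorrLength_pos (d := 3) (by norm_num) hβ hβc he0
  rw [isingCorrLength_eq_inv_dirInvCorrLength (d := 3) hβ.le, ← he]
  suffices hcm : c / ℓ ≤ dirInvCorrLength 3 β e by
    calc (dirInvCorrLength 3 β e)⁻¹ ≤ (c / ℓ)⁻¹ := inv_anti₀ (by positivity) hcm
      _ = 1 / c * ℓ := by rw [inv_div]; ring
  -- `⟨·⟩⁺ = ⟨·⟩^∅` on pairs below `β_c`
  have hfree : ∀ x, twoPointPlus 3 β x = twoPointFree 3 β x := fun x =>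
    (twoPointFree_eq_twoPointPlus_of_spontaneousMagnetization_eq_zero hβ.le
      (spontaneousMagnetization_eq_zero_of_le_criticalBeta (d := 3) (by norm_num) hβ.le hβc.le) x).symm
  -- the axial bound `⟨σ₀σ_{ne₁}⟩⁺_β ≤ C₁ e^{-cn/ℓ}`, `C₁ = C₀ ∨ 1`
  set C₁ : ℝ := max C₀ 1 with hC₁
  have hC₁1 : 1 ≤ C₁ := le_max_right _ _
  have hC₁pos : 0 < C₁ := lt_of_lt_of_le one_pos hC₁1
  have haxis : ∀ n : ℕ, 1 ≤ n →
      twoPointPlus 3 β ((n : ℤ) • e) ≤ C₁ * Real.exp (-(c * n / ℓ)) := by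
    intro n hn
    have hx : ((n : ℤ) • e : Site 3) = Pi.single 0 (n : ℤ) := by
      rw [he]
      ext j
      by_cases hj : j = 0
      · subst hj; simp
      · simp [Pi.single_eq_of_ne hj]
    have hx0 : ((n : ℤ) • e : Site 3) ≠ 0 := by
      rw [hx]
      intro h0
      have h0i := congrFun h0 0
      simp at h0i
      omega
    have hnorm : ‖((n : ℤ) • e : Site 3)‖ = n := by rw [hx, Pi.norm_single, Int.norm_natCast]
    have h := (hup β hβ.le hβc.le _ hx0).2 ℓ hℓ
    rw [hnorm] at h
    have hmin1 : (1 : ℝ) ≤ min (n : ℝ) (ℓ : ℝ) := le_min (by exact_mod_cast hn) (by exact_mod_cast hℓ1)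
    have hpow : (1 / min (n : ℝ) (ℓ : ℝ)) ^ (3 - 2) ≤ 1 :=
      pow_le_one₀ (by positivity) ((div_le_one (by positivity)).2 hmin1)
    have hexp0 : 0 ≤ Real.exp (-(c * n / ℓ)) := (Real.exp_pos _).le
    rw [hfree]
    calc twoPointFree 3 β ((n : ℤ) • e)
        ≤ C₀ * (1 / min (n : ℝ) (ℓ : ℝ)) ^ (3 - 2) * Real.exp (-(c * n / ℓ)) := h
      _ ≤ C₀ * 1 * Real.exp (-(c * n / ℓ)) := by gcongr
      _ ≤ C₁ * Real.exp (-(c * n / ℓ)) := by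
          rw [mul_one]
          exact mul_le_mul_of_nonneg_right (le_max_left _ _) hexp0
  -- pass to the limit `n → ∞`
  have hf : Tendsto (fun n : ℕ => c / ℓ - Real.log C₁ / n) atTop (𝓝 (c / ℓ - 0)) :=
    tendsto_const_nhds.sub (tendsto_const_div_atTop_nhds_zero_nat (Real.log C₁))
  rw [sub_zero] at hf
  refine le_of_tendsto_of_tendsto hf (tendsto_dirInvCorrLength hβ e) ?_
  filter_upwards [eventually_ge_atTop 1] with n hn
  have hnpos : (0 : ℝ) < n := by exact_mod_cast hn
  have hG : 0 < twoPointPlus 3 β ((n : ℤ) • e) := twoPointPlus_pos hβ _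
  have hlog : Real.log (twoPointPlus 3 β ((n : ℤ) • e)) ≤ Real.log C₁ - c * n / ℓ := by
    have h1 := Real.log_le_log hG (haxis n hn)
    rw [Real.log_mul hC₁pos.ne' (Real.exp_pos _).ne', Real.log_exp] at h1
    linarith
  rw [le_div_iff₀ hnpos]
  have e1 : (c / ℓ - Real.log C₁ / n) * n = c * n / ℓ - Real.log C₁ := by
    field_simp
  rw [e1]
  linarith

/-- **`χ(β) ≥ c ξ(β)` on `ℤ³`** (Simon's `γ ≥ ν` in amplitude form, through the sharp length): there is
`C > 0` with `ξ(β) ≤ C χ(β)` for all `0 < β < β_c(3)`. [cite: Simon1980CMP, Thm. 1] -/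
theorem isingCorrLength_le_mul_susceptibility :
    ∃ C : ℝ, 0 < C ∧ ∀ β : ℝ, 0 < β → β < criticalBeta 3 →
      isingCorrLength 3 β ≤ C * (susceptibility 3 β).toReal := by
  obtain ⟨C, hC, hξ⟩ := isingCorrLength_le_mul_sharpLength
  refine ⟨C * (12 * criticalBeta 3 + 1), ?_, fun β hβ hβc => ?_⟩
  · have := criticalBeta_nonneg 3
    positivity
  obtain ⟨ℓ, hℓ, -, -, hℓχ⟩ := exists_sharpLength_eq hβ hβc
  have hχ0 : 0 ≤ (susceptibility 3 β).toReal := ENNReal.toReal_nonneg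
  calc isingCorrLength 3 β ≤ C * ℓ := hξ β hβ hβc ℓ hℓ
    _ ≤ C * ((12 * β + 1) * (susceptibility 3 β).toReal) := mul_le_mul_of_nonneg_left hℓχ hC.le
    _ ≤ C * ((12 * criticalBeta 3 + 1) * (susceptibility 3 β).toReal) := by
        gcongr
    _ = C * (12 * criticalBeta 3 + 1) * (susceptibility 3 β).toReal := by ring

/-! ### The converse comparison: `L(β) ≤ 5 ξ(β) log ξ(β) + 1` once `ξ(β)` is large -/

/-- Points of `Λ_k` are at sup distance `≤ 2k`. [folklore] -/
theorem norm_sub_le_of_mem_box {d k : ℕ} {x y : Site d} (hx : x ∈ box d k) (hy : y ∈ box d k) :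
    ‖x - y‖ ≤ 2 * (k : ℝ) := by
  rw [pi_norm_le_iff_of_nonneg (by positivity)]
  intro i
  obtain ⟨h1, h2⟩ := mem_box.1 hx i
  obtain ⟨h3, h4⟩ := mem_box.1 hy i
  rw [Pi.sub_apply, Int.norm_eq_abs, abs_le]
  have h1' : -(k : ℝ) ≤ x i := by exact_mod_cast h1
  have h2' : (x i : ℝ) ≤ k := by exact_mod_cast h2
  have h3' : -(k : ℝ) ≤ y i := by exact_mod_cast h3
  have h4' : (y i : ℝ) ≤ k := by exact_mod_cast h4
  push_cast
  constructor <;> linarith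

/-- **Shell sums against the correlation length**: `Σ_{∂Λ_k} ⟨σ₀σ_x⟩^∅_β ≤ |∂Λ_k| e^{-k/ξ(β)}`
(`⟨·⟩^∅ ≤ ⟨·⟩⁺`, `⟨σ₀σ_x⟩⁺_β ≤ e^{-ξ_β(x)}` and `ξ_β(x) ≥ ‖x‖_∞ ξ_β(e₁) = ‖x‖_∞/ξ(β)`, Messager–Miracle-Solé). [cite: MessagerMiracleSoleJSP1977, Thm. 1] -/
theorem shellSum_le_card_mul_exp {β : ℝ} (hβ : 0 < β) (k : ℕ) :
    ∑ x ∈ sphere 3 k, twoPointFree 3 β x ≤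
      (#(sphere 3 k) : ℝ) * Real.exp (-((k : ℝ) * dirInvCorrLength 3 β (Pi.single 0 1))) := by
  calc ∑ x ∈ sphere 3 k, twoPointFree 3 β x
      ≤ ∑ _x ∈ sphere 3 k, Real.exp (-((k : ℝ) * dirInvCorrLength 3 β (Pi.single 0 1))) := by
        refine Finset.sum_le_sum fun x hx => ?_
        have hk : Site.supNorm x = k := mem_sphere.1 hx
        calc twoPointFree 3 β x ≤ twoPointPlus 3 β x :=
              twoPointFree_le_twoPointPlus_holds (d := 3) (by norm_num) hβ.le x
          _ ≤ Real.exp (-dirInvCorrLength 3 β x) := twoPointPlus_le_exp_neg_dirInvCorrLength hβ.le x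
          _ ≤ Real.exp (-((k : ℝ) * dirInvCorrLength 3 β (Pi.single 0 1))) := by
              rw [Real.exp_le_exp, neg_le_neg_iff, ← hk]
              exact supNorm_mul_dirInvCorrLength_axis_le hβ x
    _ = (#(sphere 3 k) : ℝ) * Real.exp (-((k : ℝ) * dirInvCorrLength 3 β (Pi.single 0 1))) := by
        rw [Finset.sum_const, nsmul_eq_mul]

/-- **`L(β) ≤ 5 ξ(β) log ξ(β) + 1` for `0 < β < β_c(3)` once `ξ(β) ≥ 3 ∨ (45000 β_c + 1)`**: the box
`Λ_k`, `k = ⌈5 ξ log ξ⌉`, is a witness of Def. 1.1, since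
`φ_β(Λ_k) ≤ 6β Σ_{∂Λ_k} ⟨σ₀σ_x⟩^∅_β ≤ 36 β (2k+1)² e^{-k/ξ} ≤ 22500 β/ξ < 1/2`.
[cite: DuminilCopinPanis2025LowerBounds, Def. 1.1 and §1 p. 6] -/
theorem exists_sharpLength_le_corrLength_log {β : ℝ} (hβ : 0 < β) (hβc : β < criticalBeta 3)
    (hξ : max 3 (45000 * criticalBeta 3 + 1) ≤ isingCorrLength 3 β) :
    ∃ k : ℕ, sharpLength 3 β ≤ k ∧
      (k : ℝ) ≤ 5 * isingCorrLength 3 β * Real.log (isingCorrLength 3 β) + 1 := by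
  set ξ : ℝ := isingCorrLength 3 β with hξdef
  set e : Site 3 := Pi.single 0 1 with he
  have he0 : e ≠ 0 := by
    intro h0
    have h0i := congrFun h0 0
    simp [he] at h0i
  set m : ℝ := dirInvCorrLength 3 β e with hmdef
  have hm : 0 < m := dirInvCorrLength_pos (d := 3) (by norm_num) hβ hβc he0
  have hξm : ξ = m⁻¹ := by rw [hξdef, isingCorrLength_eq_inv_dirInvCorrLength (d := 3) hβ.le]
  have hξ3 : 3 ≤ ξ := le_trans (le_max_left _ _) hξ
  have hξβ : 45000 * criticalBeta 3 + 1 ≤ ξ := le_trans (le_max_right _ _) hξ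
  have hξpos : 0 < ξ := by linarith
  have hξm1 : ξ * m = 1 := by rw [hξm, inv_mul_cancel₀ hm.ne']
  have hlog1 : 1 ≤ Real.log ξ := by
    have h3 : Real.exp 1 ≤ ξ := by
      have := Real.exp_one_lt_d9
      linarith
    calc (1 : ℝ) = Real.log (Real.exp 1) := (Real.log_exp 1).symm
      _ ≤ Real.log ξ := Real.log_le_log (Real.exp_pos 1) h3
  have hlogξ : Real.log ξ ≤ ξ := (Real.log_le_sub_one_of_pos hξpos).trans (by linarith)
  set t : ℝ := 5 * ξ * Real.log ξ with ht
  have ht1 : 1 ≤ t := by nlinarith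
  have ht0 : 0 ≤ t := by linarith
  have hceil_ge : t ≤ (⌈t⌉₊ : ℝ) := Nat.le_ceil t
  have hceil_lt : (⌈t⌉₊ : ℝ) < t + 1 := Nat.ceil_lt_add_one ht0
  have hceil1 : 1 ≤ ⌈t⌉₊ := by
    have : (1 : ℝ) ≤ ⌈t⌉₊ := ht1.trans hceil_ge
    exact_mod_cast this
  obtain ⟨k', hk'⟩ : ∃ k' : ℕ, ⌈t⌉₊ = k' + 1 := ⟨⌈t⌉₊ - 1, (Nat.sub_add_cancel hceil1).symm⟩
  rw [hk'] at hceil_ge hceil_lt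
  push_cast at hceil_ge hceil_lt
  refine ⟨k' + 1, ?_, by push_cast; linarith⟩
  apply sharpLength_le
  refine ⟨by omega, box 3 (k' + 1), zero_mem_box 3 (k' + 1),
    fun x hx y hy => norm_sub_le_of_mem_box hx hy, ?_⟩
  -- the exponential factor: `e^{-(k'+1) m} ξ⁵ ≤ 1`
  set E : ℝ := Real.exp (-(((k' + 1 : ℕ) : ℝ) * m)) with hE
  have hE0 : 0 ≤ E := (Real.exp_pos _).le
  have hE5 : ξ ^ 5 * E ≤ 1 := by
    have h5 : 5 * Real.log ξ ≤ ((k' + 1 : ℕ) : ℝ) * m := by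
      push_cast
      calc 5 * Real.log ξ = t * m := by
            rw [ht]
            calc 5 * Real.log ξ = 5 * Real.log ξ * (ξ * m) := by rw [hξm1, mul_one]
              _ = 5 * ξ * Real.log ξ * m := by ring
        _ ≤ ((k' : ℝ) + 1) * m := mul_le_mul_of_nonneg_right hceil_ge hm.le
    have hE' : E ≤ Real.exp (-(5 * Real.log ξ)) := by
      rw [hE, Real.exp_le_exp]
      linarith
    have hexp5 : Real.exp (5 * Real.log ξ) = ξ ^ 5 := by
      rw [show (5 : ℝ) * Real.log ξ = ((5 : ℕ) : ℝ) * Real.log ξ by norm_num, Real.exp_nat_mul,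
        Real.exp_log hξpos]
    calc ξ ^ 5 * E ≤ ξ ^ 5 * Real.exp (-(5 * Real.log ξ)) :=
          mul_le_mul_of_nonneg_left hE' (by positivity)
      _ = 1 := by rw [Real.exp_neg, hexp5, mul_inv_cancel₀ (by positivity)]
  -- the polynomial factor: `(2k'+3)² ≤ 625 ξ⁴`
  have hk3 : 2 * (k' : ℝ) + 3 ≤ 5 * t := by linarith
  have hsq : (2 * (k' : ℝ) + 3) ^ 2 ≤ 625 * ξ ^ 4 := by
    have h1 : (2 * (k' : ℝ) + 3) ^ 2 ≤ (5 * t) ^ 2 :=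
      pow_le_pow_left₀ (by positivity) hk3 2
    have hlog2 : Real.log ξ ^ 2 ≤ ξ ^ 2 := pow_le_pow_left₀ (by linarith) hlogξ 2
    have h2 : (5 * t) ^ 2 ≤ 625 * ξ ^ 4 := by
      rw [ht]
      have hξ2 : 0 ≤ ξ ^ 2 := by positivity
      calc (5 * (5 * ξ * Real.log ξ)) ^ 2 = 625 * ξ ^ 2 * Real.log ξ ^ 2 := by ring
        _ ≤ 625 * ξ ^ 2 * ξ ^ 2 := by gcongr
        _ = 625 * ξ ^ 4 := by ring
    exact h1.trans h2
  -- assemble: `φ_β(Λ_{k'+1}) ≤ 36 β (2k'+3)² E ≤ 22500 β ξ⁴ E ≤ 22500 β / ξ < 1/2`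
  have hcard : (#(sphere 3 (k' + 1)) : ℝ) ≤ 6 * (2 * (k' : ℝ) + 3) ^ 2 := by
    have h := card_sphere_succ_le (d := 3) k'
    norm_num at h
    linarith
  have hS : ∑ x ∈ sphere 3 (k' + 1), twoPointFree 3 β x ≤ 6 * (2 * (k' : ℝ) + 3) ^ 2 * E := by
    have h1 := shellSum_le_card_mul_exp hβ (k' + 1)
    refine h1.trans ?_
    rw [← hmdef, ← hE]
    exact mul_le_mul_of_nonneg_right hcard hE0
  have hφ : dcpPhi 3 β (box 3 (k' + 1)) ≤ 36 * β * ((2 * (k' : ℝ) + 3) ^ 2 * E) := by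
    calc dcpPhi 3 β (box 3 (k' + 1))
        ≤ β * (2 * ((3 : ℕ) : ℝ)) * ∑ x ∈ sphere 3 (k' + 1), twoPointFree 3 β x :=
          dcpPhi_box_succ_le hβ.le k'
      _ ≤ β * (2 * ((3 : ℕ) : ℝ)) * (6 * (2 * (k' : ℝ) + 3) ^ 2 * E) :=
          mul_le_mul_of_nonneg_left hS (by positivity)
      _ = 36 * β * ((2 * (k' : ℝ) + 3) ^ 2 * E) := by push_cast; ring
  have hpoly : (2 * (k' : ℝ) + 3) ^ 2 * E ≤ 625 * (ξ ^ 4 * E) := by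
    calc (2 * (k' : ℝ) + 3) ^ 2 * E ≤ 625 * ξ ^ 4 * E := mul_le_mul_of_nonneg_right hsq hE0
      _ = 625 * (ξ ^ 4 * E) := by ring
  have hinv : ξ ^ 4 * E ≤ ξ⁻¹ := by
    have h1 : ξ⁻¹ * (ξ ^ 5 * E) = ξ ^ 4 * E := by
      rw [← mul_assoc, pow_succ', ← mul_assoc, inv_mul_cancel₀ hξpos.ne', one_mul]
    rw [← h1]
    calc ξ⁻¹ * (ξ ^ 5 * E) ≤ ξ⁻¹ * 1 := mul_le_mul_of_nonneg_left hE5 (inv_nonneg.2 hξpos.le)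
      _ = ξ⁻¹ := mul_one _
  have hlast : 22500 * β * ξ⁻¹ < 1 / 2 := by
    rw [mul_inv_lt_iff₀ hξpos]
    linarith [hβc.le]
  calc dcpPhi 3 β (box 3 (k' + 1)) ≤ 36 * β * ((2 * (k' : ℝ) + 3) ^ 2 * E) := hφ
    _ ≤ 36 * β * (625 * (ξ ^ 4 * E)) := mul_le_mul_of_nonneg_left hpoly (by positivity)
    _ ≤ 36 * β * (625 * ξ⁻¹) :=
        mul_le_mul_of_nonneg_left (mul_le_mul_of_nonneg_left hinv (by norm_num)) (by positivity)
    _ = 22500 * β * ξ⁻¹ := by ring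
    _ < 1 / 2 := hlast


end Literature.Probability.LatticeModels

end
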